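import Literature.NumberTheory.EllipticCurves.ZpExtensionEisensteinTowerReadoutBijectiveProofs
import Literature.NumberTheory.EllipticCurves.ZpExtensionEisensteinH1Limit
import Literature.NumberTheory.EllipticCurves.ZpExtensionEisensteinSelmerTowerCompatProofs
import HarnessLib

/-!
# Howard's readout intertwines `[T] ∈ S_m` with `conj_γ − 1` on `H¹(K_∞, E[p^∞])` (proofs file)

Topic `NumberTheory/EllipticCurves` (cell `pub/bsd-print-x9`, blueprint HOME/p2/S1-DISCRETE-CONTROL §1(d) «hιΛ»; sequel to
`IwasawaEisensteinTwistedRepH1TransportProofs` (level readout of `[ξ]` = class of the last coordinate; shift relations) and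
`ZpExtensionEisensteinTowerReadoutBijectiveProofs`). THEOREMS ONLY; no definition, no named fact, no instance, no `sorry`.

* `ZpExtension.eisensteinTwistLevelReadout_scalarMapH1_mk_X` — for a class `c` of `H¹(K, M ⊗ A_{m,k}(χ))`
  (`χ γ · (1+T) = 1`): `readout ([T] • c) = conj_γ (readout c) − readout c` in `H¹(K_∞, M)` — the last coordinate of
  `[T] • ξ` is the `(m−2)`-nd coordinate of `ξ` (`[T]` shifts coordinates, `[T]^m = −p`), and the shift relation
  `conj_γ [φ_{m−1}] = [φ_{m−1}] + [φ_{m−2}]` (`conjH1_oneCocycleClass_coord_eq`);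
* `WeierstrassCurve.eisensteinTowerReadout_of_scalarMapH1_mk_X` — **binder (B3)** for the curve: on representatives of
  `H¹(K, A_𝔮) = colim_j H¹(K, E[p^{j+1}] ⊗ A_{m,j+1}(ψ⁻¹))`, Howard's readout satisfies
  `readout (of j (H¹([X]•) c)) = θ (readout (of j c)) − readout (of j c)` for `θ = conj_γ`, i.e. the Eisenstein variable
  `T = [X] ∈ S_m = Λ/(T^m + p)` acts on `H¹(K, A_𝔮)` as `γ − 1` does on `H¹(K_∞, E[p^∞])[𝔮]` — the compatibility `hιΛ`
  (at the generator `T`; constants are formal) of the dual control map `SelmerDualData.exists_linearMap_quotSMulTop_qm_characterModule`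
  (`toDual_T_smul`: `⟨T x, s⟩ = ⟨x, (conj_γ − 1) s⟩`).

References: [Howard2004HeegnerKolyvagin] §2.2 (Λ acts on `T_𝔮 = T ⊗ S_𝔮` through `γ ↦ 1 + T`), proof of Thm. 2.2.10;
[GreenbergLNM1716] §4 pp. 98, 107, 124; [Washington1997] §13.2.  BSD is not proved by any of this.
-/

noncomputable section

open scoped Classical

open Literature.NumberTheory.EllipticCurves Literature.NumberTheory.GaloisRepresentations Field
open Literature.NumberTheory.GaloisRepresentations.galoisCohomology
open Literature.NumberTheory.GaloisCohomology.Howard2004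
open IwasawaAlgebra IwasawaAlgebra.EisensteinCoeff IwasawaAlgebra.EisensteinCoeff.TwistedBy

universe u

/-! ## §1 Level `k`: `readout ([T] • c) = (conj_γ − 1) (readout c)` -/

namespace Literature.NumberTheory.EllipticCurves

namespace ZpExtension

variable {K : Type u} [Field K] {p : ℕ} [hp : Fact p.Prime] (κ : ZpExtension K p) {m : ℕ} (hm : 1 ≤ m) (k : ℕ)
  {M : Type u} [AddCommGroup M] [DistribMulAction (absoluteGaloisGroup K) M] [TopologicalSpace M] [DiscreteTopology M]
  (χ : absoluteGaloisGroup K →* EisensteinCoeff p m k) (ρ : DiscreteGaloisModule K M)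
  (hact : ∀ (σ : absoluteGaloisGroup K) (x : Twisted p m k M),
    κ.eisensteinTwist ρ hm k σ x = (ofTwisted χ M).symm (σ • ofTwisted χ M x))
  (κ₀ : ZpExtension K p) (hM : ∀ a : M, p ^ k • a = 0) (hχker : ∀ σ ∈ κ₀.kerSubgroup, χ σ = 1)

/-- **`readout ([T] • c) = conj_γ (readout c) − readout c`** for every class `c` of `H¹(K, M ⊗ A_{m,k}(χ))`, `γ` a
topological generator with `χ γ · (1+T) = 1`: the level readout intertwines the scalar `[T] = [X] ∈ A_{m,k}`
(`scalarMapH1`) with `conj_γ − 1` on `H¹(K_∞, M)`.  On a cocycle `ξ` with coordinate cocycles `φ_j`: the readout of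
`[T] • ξ` is the class of `h ↦ λ_k([π_{m−1}^*][T] ξ h) = φ_{m−2}(h)` (`−p φ_{m-1}(h)` if `m = 1`) by the shift lemma
`tailReadout_dualFamily_smul_X_smul`, and `conj_γ [φ_{m−1}] − [φ_{m−1}]` is the same class by
`conjH1_oneCocycleClass_coord_eq`. [cite: Howard2004HeegnerKolyvagin, §2.2 and proof of Thm. 2.2.10 (𝔮 = T^m + p)]
[cite: GreenbergLNM1716, §4 pp. 107, 124] -/
theorem eisensteinTwistLevelReadout_scalarMapH1_mk_X {γ : absoluteGaloisGroup K}
    (hχγ : χ γ * EisensteinCoeff.onePlusT p m k = 1) (c : galoisCohomology (κ.eisensteinTwist ρ hm k) 1) :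
    κ.eisensteinTwistLevelReadout hm k χ ρ hact κ₀ hM hχker
        (scalarMapH1 (κ.eisensteinTwist ρ hm k) (κ.isScalarLinear_eisensteinTwist ρ hm k)
          (Ideal.Quotient.mk _ (PowerSeries.X : IwasawaAlgebra p) : EisensteinCoeff p m k) c) =
      conjH1 κ₀.kerSubgroup M γ (κ.eisensteinTwistLevelReadout hm k χ ρ hact κ₀ hM hχker c) -
        κ.eisensteinTwistLevelReadout hm k χ ρ hact κ₀ hM hχker c := by
  obtain ⟨ξ, rfl⟩ := oneCocycleClass_surjective _ c
  obtain ⟨φ, hφ⟩ := κ.exists_coordCocycles hm k χ ρ hact κ₀ hM hχker ξ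
  set ξ' := scalarCocycle (κ.eisensteinTwist ρ hm k) (κ.isScalarLinear_eisensteinTwist ρ hm k)
    (Ideal.Quotient.mk _ (PowerSeries.X : IwasawaAlgebra p) : EisensteinCoeff p m k) ξ with hξ'
  obtain ⟨φ', hφ'⟩ := κ.exists_coordCocycles hm k χ ρ hact κ₀ hM hχker ξ'
  have hlast : m - 1 < m := Nat.sub_lt (lt_of_lt_of_le zero_lt_one hm) zero_lt_one
  rw [scalarMapH1_oneCocycleClass, κ.eisensteinTwistLevelReadout_oneCocycleClass hm k χ ρ hact κ₀ hM hχker ξ' φ' hφ',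
    κ.eisensteinTwistLevelReadout_oneCocycleClass hm k χ ρ hact κ₀ hM hχker ξ φ hφ,
    IwasawaDual.conjH1_oneCocycleClass_coord_eq κ₀ hm k hM χ (map_mul χ) hχker hχγ (fun σ ↦ ξ.1 σ)
      (κ.eisensteinTwist_contOneCocycles_apply_mul hm k χ ρ hact ξ) φ hφ ⟨m - 1, hlast⟩, add_sub_cancel_left]
  -- the last coordinate of `[T] • ξ` against the shift lemma
  have hval : ∀ h : κ₀.kerSubgroup, (φ' ⟨m - 1, hlast⟩).1 h =
      if ((⟨m - 1, hlast⟩ : Fin m) : ℕ) = 0 then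
        -(p • (φ ⟨m - 1, Nat.sub_lt (lt_of_lt_of_le zero_lt_one hm) zero_lt_one⟩).1 h)
      else (φ ⟨((⟨m - 1, hlast⟩ : Fin m) : ℕ) - 1, lt_of_le_of_lt (Nat.sub_le _ _) hlast⟩).1 h := fun h ↦ by
    rw [hφ', hξ', scalarCocycle_apply, IwasawaDual.tailReadout_dualFamily_smul_X_smul hm k hM, hφ, hφ]
  by_cases h0 : ((⟨m - 1, hlast⟩ : Fin m) : ℕ) = 0
  · rw [if_pos h0]
    have hns : oneCocycleClass (discreteTopRep κ₀.kerSubgroup M)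
        (-(p • φ ⟨m - 1, Nat.sub_lt (lt_of_lt_of_le zero_lt_one hm) zero_lt_one⟩)) =
        -(p • oneCocycleClass _ (φ ⟨m - 1, Nat.sub_lt (lt_of_lt_of_le zero_lt_one hm) zero_lt_one⟩)) := by
      rw [← oneCocycleClassₗ_apply, ← oneCocycleClassₗ_apply, map_neg, map_nsmul]
    rw [← hns]
    refine congrArg _ (Subtype.ext (ContinuousMap.ext fun h ↦ ?_))
    rw [hval h, if_pos h0]
    rfl
  · rw [if_neg h0]
    refine congrArg _ (Subtype.ext (ContinuousMap.ext fun h ↦ ?_))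
    rw [hval h, if_neg h0]

end ZpExtension

end Literature.NumberTheory.EllipticCurves

/-! ## §2 The curve: `readout (of j ([X] • c)) = (conj_γ − 1) (readout (of j c))` on `H¹(K, A_𝔮)` -/

namespace WeierstrassCurve

open Literature.NumberTheory.EllipticCurves.ZpExtension (EisensteinLevel)

variable {K : Type} [Field K] [NumberField K] (W : WeierstrassCurve ℚ) [W.IsElliptic] {p : ℕ} [hp : Fact p.Prime]
  (κ : ZpExtension K p) {m : ℕ} (hm : 1 ≤ m)

variable (π : IwasawaAlgebra p ⧸ Ideal.span {(PowerSeries.X ^ m + PowerSeries.C (p : ℤ_[p]) : IwasawaAlgebra p)})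
  (e : ℕ → ℕ)
  (hkill : letI := IwasawaAlgebra.isLocalRing_quotient_X_pow_add_C p hm
    ∀ k, ∀ r ∈ IsLocalRing.maximalIdeal
      (IwasawaAlgebra p ⧸ Ideal.span {(PowerSeries.X ^ m + PowerSeries.C (p : ℤ_[p]) : IwasawaAlgebra p)}) ^ e k,
      ∀ x : EisensteinLevel p m (fun j ↦ geomTorsion (W.baseChange K) ((p : ℤ) ^ j)) (k + 1), r • x = 0)
  (hker : letI := IwasawaAlgebra.isLocalRing_quotient_X_pow_add_C p hm
    ∀ k, LinearMap.ker ((W.eisensteinTower (κ.unitTwist (-1)) hm).red k) =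
      (IsLocalRing.maximalIdeal
        (IwasawaAlgebra p ⧸ Ideal.span {(PowerSeries.X ^ m + PowerSeries.C (p : ℤ_[p]) : IwasawaAlgebra p)}) ^ e k) •
        (⊤ : Submodule (IwasawaAlgebra p ⧸ Ideal.span {(PowerSeries.X ^ m + PowerSeries.C (p : ℤ_[p]) : IwasawaAlgebra p)})
          (EisensteinLevel p m (fun j ↦ geomTorsion (W.baseChange K) ((p : ℤ) ^ j)) (k + 1 + 1))))
  (hπ : letI := IwasawaAlgebra.isLocalRing_quotient_X_pow_add_C p hm
    π ∈ IsLocalRing.maximalIdeal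
      (IwasawaAlgebra p ⧸ Ideal.span {(PowerSeries.X ^ m + PowerSeries.C (p : ℤ_[p]) : IwasawaAlgebra p)}))
  (he : ∀ k, e k ≤ e (k + 1))
  (hπX : π = Ideal.Quotient.mk _ PowerSeries.X) (hek : ∀ k, e (k + 1) - e k = m)

/-- **(B3) The Eisenstein variable acts on `H¹(K, A_𝔮)` as `γ − 1` on `H¹(K_∞, E[p^∞])`** (on representatives: the
tower readout of `of j (H¹([X]•) c)`, `[X] ∈ S_m = Λ/(T^m+p)` acting on level `j` through `scalarMapH1`, is
`θ r − r` for `r` the readout of `of j c` and `θ = conj_γ`) — the `T`-part of the pairing compatibility `hιΛ` of the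
dual control map at `q_m` (`SelmerDualData.toDual_T_smul`). Howard: `Λ` acts on `T_𝔮 = T ⊗ S_𝔮` through `γ ↦ γ·1 = 1 + T`.
[cite: Howard2004HeegnerKolyvagin, §2.2 and proof of Thm. 2.2.10 (𝔮 = T^m + p)] [cite: GreenbergLNM1716, §4 pp. 98, 124] -/
theorem eisensteinTowerReadout_of_scalarMapH1_mk_X {γ : absoluteGaloisGroup K} (hγ : κ.IsTopGenerator γ)
    (θ : AddMonoid.End ((W.baseChange K).subgroupH1 p κ.kerSubgroup))
    (hθ : ∀ c, θ c = (W.baseChange K).conjH1 p κ.kerSubgroup γ c) (j : ℕ) :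
    letI := IwasawaAlgebra.isLocalRing_quotient_X_pow_add_C p hm
    ∀ c : galoisCohomology ((W.eisensteinTower (κ.unitTwist (-1)) hm).ρ j) 1,
      W.eisensteinTowerReadout κ hm π e hkill hker hπ he hπX hek
          (AddCommGroup.DirectLimit.of _ _ j
            (scalarMapH1 _ ((W.eisensteinTower (κ.unitTwist (-1)) hm).hlin j)
              (Ideal.Quotient.mk _ (PowerSeries.X : IwasawaAlgebra p)) c)) =
        θ (W.eisensteinTowerReadout κ hm π e hkill hker hπ he hπX hek (AddCommGroup.DirectLimit.of _ _ j c)) -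
          W.eisensteinTowerReadout κ hm π e hkill hker hπ he hπX hek (AddCommGroup.DirectLimit.of _ _ j c) := by
  letI := IwasawaAlgebra.isLocalRing_quotient_X_pow_add_C p hm
  intro c
  -- `[X]_{S_m}` and `[X]_{A_{m,j+1}}` act by the same endomorphism of the level
  have hsc : scalarMapH1 _ ((W.eisensteinTower (κ.unitTwist (-1)) hm).hlin j)
        (Ideal.Quotient.mk _ (PowerSeries.X : IwasawaAlgebra p)) =
      scalarMapH1 ((κ.unitTwist (-1)).eisensteinTwist ((W.baseChange K).torsionGaloisModule ((p : ℤ) ^ (j + 1))) hm (j + 1))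
        ((κ.unitTwist (-1)).isScalarLinear_eisensteinTwist _ hm (j + 1))
        (Ideal.Quotient.mk _ (PowerSeries.X : IwasawaAlgebra p) : EisensteinCoeff p m (j + 1)) :=
    scalarMapH1_eq_of_forall_smul_eq _ _ fun x ↦ EisensteinLevel.quotient_mk_smul_def (j + 1) PowerSeries.X x
  have key := (κ.unitTwist (-1)).eisensteinTwistLevelReadout_scalarMapH1_mk_X hm (j + 1)
    ((κ.unitTwist (-1)).eisensteinTwistChar hm (j + 1)) ((W.baseChange K).torsionGaloisModule ((p : ℤ) ^ (j + 1)))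
    (fun σ x ↦ (κ.unitTwist (-1)).eisensteinTwist_torsionGaloisModule_apply hm (j + 1) (W.baseChange K) _ σ x) κ
    (fun a ↦ (W.baseChange K).geomTorsion_pow_nsmul_eq_zero p (j + 1) a)
    (fun _ hσ ↦ κ.eisensteinTwistChar_unitTwist_eq_one_of_mem_kerSubgroup hm (j + 1) (-1) hσ)
    (κ.eisensteinTwistChar_unitTwist_neg_one_mul_onePlusT hm (j + 1) hγ) c
  rw [← hsc] at key
  rw [WeierstrassCurve.eisensteinTowerReadout, ZpExtension.eisensteinTowerReadout_of, ZpExtension.eisensteinTowerReadout_of,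
    ZpExtension.eisensteinTowerLevelMap_apply, ZpExtension.eisensteinTowerLevelMap_apply]
  erw [key]
  rw [map_sub, W.resH1Hom_inclusion_conjH1 κ γ (j + 1), zsmul_sub, hθ, map_zsmul]

end WeierstrassCurve
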